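import Summits.CriticalPhenomena.PercolationContinuityZ3.Theorems.PercNearOneGluingNoHeavyLowerTailSahiGridPatternHarrisEquality

/-!
# `NoHeavyLowerTail` (crux stmt-CriticalPhenomena-4575), Sahi programme P1: **ON THE INDEPENDENT-PAIR FACE THE ZERO LOCUS OF THE PATTERN
# FUNCTIONAL IS EXACTLY THE SATURATED FAMILY** (every dimension)

Support file (Sahi cell, seat `prim-sahi-p1`, generation 14; `--supports stmt-CriticalPhenomena-4575`).  Pure proofs, no definitions, no `sorry`,
standard axioms.  For up-sets `A` (`I`-measurable), `B` (`J`-measurable, `I ∩ J = ∅`) and `C` of `[3]^d`: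
`sStarD A B C = 0 ⟺ (∃ I', A I'-measurable ∧ B ∩ C invariant under changing the I'-coordinates) ∧ (∃ J', B J'-measurable ∧ A ∩ C invariant under
changing the J'-coordinates)` (`sStarD_eq_zero_iff_saturated_of_indepSlots`).  ⟸ is `sStarD_eq_zero_of_indepSlots_saturated` (…ZeroLocus) on the blocks
`I ∩ I'`, `J ∩ J'`; ⟹ uses the two-slack formula `sStarD A B C = (2^d|ABC| − N(A;BC)) + (2^d|ABC| − N(B;AC))` (…ZeroLocus), coefficientwise Harris
(each slack `≥ 0`, …Harris) and the equality case of coefficientwise Harris (`exists_indep_of_harrisSlack_eq_zero`, …HarrisEquality).  Also the face `C = ⊤`: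
`sStarD A B ⊤ = 2^d|A∩B| − N(A;B)` IS the coefficientwise-Harris slack (`sStarD_univ_eq_harrisSlack`, any `A, B`), so for up-sets `sStarD A B ⊤ = 0 ⟺ A ⊥ B`
(`sStarD_univ_eq_zero_iff`).  HONEST LABEL:
equality cases only; `PatternPos d` (`d ≥ 5`), Sahi's `C₃` and Kahn's conjecture remain OPEN. [this work]
-/

namespace Summit.CriticalPhenomena.PercolationContinuityZ3.Theorems.SahiGridPattern

open Finset SahiGrid3
open scoped BigOperators

variable {n d : ℕ}

/-! ### The zero locus on the independent-pair face -/

/-- **ON THE INDEPENDENT-PAIR FACE THE ZERO LOCUS OF THE PATTERN FUNCTIONAL IS EXACTLY THE SATURATED FAMILY** (every `d`).  For up-sets `A`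
(`I`-measurable), `B` (`J`-measurable, `I ∩ J = ∅`) and `C` of `[3]^d`: `sStarD A B C = 0` iff there are blocks `I'`, `J'` with `A` `I'`-measurable and
`B ∩ C` invariant under changing the `I'`-coordinates, and `B` `J'`-measurable and `A ∩ C` invariant under changing the `J'`-coordinates. [this work] -/
theorem sStarD_eq_zero_iff_saturated_of_indepSlots {d : ℕ} (I J : Finset (Fin d)) (hIJ : Disjoint I J) {A B C : Finset (Pd d)}
    (hA : IsUpperSet (A : Set (Pd d))) (hB : IsUpperSet (B : Set (Pd d))) (hC : IsUpperSet (C : Set (Pd d)))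
    (hAI : ∀ x y : Pd d, (∀ a ∈ I, x a = y a) → (x ∈ A ↔ y ∈ A))
    (hBJ : ∀ x y : Pd d, (∀ a ∈ J, x a = y a) → (x ∈ B ↔ y ∈ B)) :
    sStarD A B C = 0 ↔
      ((∃ I' : Finset (Fin d), (∀ x y : Pd d, (∀ a ∈ I', x a = y a) → (x ∈ A ↔ y ∈ A)) ∧
          (∀ x y : Pd d, (∀ a ∉ I', x a = y a) → (x ∈ B ∩ C ↔ y ∈ B ∩ C))) ∧
       (∃ J' : Finset (Fin d), (∀ x y : Pd d, (∀ a ∈ J', x a = y a) → (x ∈ B ↔ y ∈ B)) ∧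
          (∀ x y : Pd d, (∀ a ∉ J', x a = y a) → (x ∈ A ∩ C ↔ y ∈ A ∩ C)))) := by
  have hBI : ∀ x y : Pd d, (∀ a ∉ I, x a = y a) → (x ∈ B ↔ y ∈ B) := fun x y h =>
    hBJ x y fun a ha => h a (fun haI => Finset.disjoint_left.1 hIJ haI ha)
  have hAJ : ∀ x y : Pd d, (∀ a ∉ J, x a = y a) → (x ∈ A ↔ y ∈ A) := fun x y h =>
    hAI x y fun a ha => h a (fun haJ => Finset.disjoint_left.1 hIJ ha haJ)
  have hBC : IsUpperSet ((B ∩ C : Finset (Pd d)) : Set (Pd d)) := by rw [Finset.coe_inter]; exact hB.inter hC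
  have hAC : IsUpperSet ((A ∩ C : Finset (Pd d)) : Set (Pd d)) := by rw [Finset.coe_inter]; exact hA.inter hC
  -- the two Harris slacks
  have H1 := sum_ind_totDist_le d A (B ∩ C) hA hBC
  have H2 := sum_ind_totDist_le d B (A ∩ C) hB hAC
  have e1 : (∑ p, ∑ q, ind A p * ind (B ∩ C) q * (if TotDist p q = true then (1:ℤ) else 0)) =
      ∑ p, ∑ q, ind A p * ind B q * ind C q * (if TotDist p q = true then (1:ℤ) else 0) :=
    Finset.sum_congr rfl fun p _ => Finset.sum_congr rfl fun q _ => by rw [ind_inter_eq_mul]; ring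
  have e1' : (∑ p, ind A p * ind (B ∩ C) p) = ∑ p, ind A p * ind B p * ind C p :=
    Finset.sum_congr rfl fun p _ => by rw [ind_inter_eq_mul]; ring
  have e2 : (∑ p, ∑ q, ind B p * ind (A ∩ C) q * (if TotDist p q = true then (1:ℤ) else 0)) =
      ∑ p, ∑ q, ind B p * ind A q * ind C q * (if TotDist p q = true then (1:ℤ) else 0) :=
    Finset.sum_congr rfl fun p _ => Finset.sum_congr rfl fun q _ => by rw [ind_inter_eq_mul]; ring
  have e2' : (∑ p, ind B p * (ind (A ∩ C) p)) = ∑ p, ind A p * ind B p * ind C p :=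
    Finset.sum_congr rfl fun p _ => by rw [ind_inter_eq_mul]; ring
  have hS := sStarD_eq_two_harrisSlacks_of_indepSlots I C hAI hBI
  constructor
  · intro h0
    rw [h0] at hS
    have z1 : (∑ p, ∑ q, ind A p * ind (B ∩ C) q * (if TotDist p q = true then (1:ℤ) else 0)) = 2 ^ d * ∑ p, ind A p * ind (B ∩ C) p := by
      rw [e1, e1']; rw [e1, e1'] at H1; rw [e2, e2'] at H2; linarith
    have z2 : (∑ p, ∑ q, ind B p * ind (A ∩ C) q * (if TotDist p q = true then (1:ℤ) else 0)) = 2 ^ d * ∑ p, ind B p * ind (A ∩ C) p := by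
      rw [e2, e2']; rw [e1, e1'] at H1; rw [e2, e2'] at H2; linarith
    obtain ⟨I', hAI', hBCI'⟩ := exists_indep_of_harrisSlack_eq_zero d A (B ∩ C) hA hBC z1
    obtain ⟨J', hBJ', hACJ'⟩ := exists_indep_of_harrisSlack_eq_zero d B (A ∩ C) hB hAC z2
    exact ⟨⟨I', hAI', hBCI'⟩, ⟨J', hBJ', hACJ'⟩⟩
  · rintro ⟨⟨I', hAI', hBCI'⟩, ⟨J', hBJ', hACJ'⟩⟩
    refine sStarD_eq_zero_of_indepSlots_saturated (I ∩ I') (J ∩ J')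
      (Finset.disjoint_of_subset_left Finset.inter_subset_left (Finset.disjoint_of_subset_right Finset.inter_subset_left hIJ))
      (meas_inter hAI hAI') (meas_inter hBJ hBJ') (fun x y hxy hx => ?_) (fun x y hxy hx => ?_)
    · have hy : y ∈ B := (hBJ x y fun a ha => hxy a (fun h => Finset.disjoint_left.1 hIJ (Finset.mem_inter.1 h).1 ha)).1 hx
      have h' := hBCI' x y fun a ha => hxy a (fun h => ha (Finset.mem_inter.1 h).2)
      rw [Finset.mem_inter, Finset.mem_inter] at h'
      exact ⟨fun hxC => (h'.1 ⟨hx, hxC⟩).2, fun hyC => (h'.2 ⟨hy, hyC⟩).2⟩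
    · have hy : y ∈ A := (hAI x y fun a ha => hxy a (fun h => Finset.disjoint_left.1 hIJ ha (Finset.mem_inter.1 h).1)).1 hx
      have h' := hACJ' x y fun a ha => hxy a (fun h => ha (Finset.mem_inter.1 h).2)
      rw [Finset.mem_inter, Finset.mem_inter] at h'
      exact ⟨fun hxC => (h'.1 ⟨hx, hxC⟩).2, fun hyC => (h'.2 ⟨hy, hyC⟩).2⟩


/-! ### The face `C = ⊤`: the pattern functional is one coefficientwise-Harris slack -/

/-- `N(B;A) = N(A;B)`: the totally-distinct pair count is symmetric. [this work] -/
theorem sum_td_swap (A B : Finset (Pd d)) :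
    (∑ p, ∑ q, ind B p * ind A q * (if TotDist p q = true then (1:ℤ) else 0)) =
      ∑ p, ∑ q, ind A p * ind B q * (if TotDist p q = true then (1:ℤ) else 0) := by
  rw [Finset.sum_comm]
  refine Finset.sum_congr rfl fun p _ => Finset.sum_congr rfl fun q _ => ?_
  rw [totDist_symm q p]; ring

/-- **On the face `C = ⊤` the pattern functional IS the coefficientwise-Harris slack**: `sStarD A B ⊤ = 2^d|A∩B| − N(A;B)` (every `d`, any `A, B`). [this work] -/
theorem sStarD_univ_eq_harrisSlack (A B : Finset (Pd d)) :
    sStarD A B univ = 2 ^ d * (∑ p, ind A p * ind B p) - (∑ p, ∑ q, ind A p * ind B q * (if TotDist p q = true then (1:ℤ) else 0)) := by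
  rw [sStarD_swap23, sStarD_swap12, sStarD_counting]
  have hu : ∀ p : Pd d, ind (univ : Finset (Pd d)) p = 1 := fun p => by unfold ind; rw [if_pos (Finset.mem_univ p)]
  simp only [hu, one_mul, mul_one]
  have h1 : (∑ p : Pd d, ∑ q : Pd d, ind A q * ind B q * (if TotDist p q = true then (1:ℤ) else 0)) = 2 ^ d * ∑ q, ind A q * ind B q := by
    rw [Finset.sum_comm, Finset.mul_sum]
    refine Finset.sum_congr rfl fun q _ => ?_
    have e0 : (∑ x : Pd d, ind A q * ind B q * (if TotDist x q = true then (1:ℤ) else 0)) =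
        ind A q * ind B q * ∑ x : Pd d, (if TotDist x q = true then (1:ℤ) else 0) := by rw [Finset.mul_sum]
    have e : ∀ p : Pd d, (if TotDist p q = true then (1:ℤ) else 0) = (if TotDist q p = true then (1:ℤ) else 0) :=
      fun p => by rw [totDist_symm p q]
    have h2 : (∑ p : Pd d, (if TotDist p q = true then (1:ℤ) else 0)) = 2 ^ d := by
      rw [Finset.sum_congr rfl fun p _ => e p]; exact sum_ite_totDist_eq_two_pow q
    rw [e0, h2]; ring
  rw [h1, sum_td_swap A B]; ring

/-- **ZERO LOCUS ON THE FACE `C = ⊤`** (every `d`): for up-sets `A, B`, `sStarD A B ⊤ = 0` iff `A` and `B` are measurable with respect to complementary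
blocks of axes (an independent pair). [this work] -/
theorem sStarD_univ_eq_zero_iff {A B : Finset (Pd d)} (hA : IsUpperSet (A : Set (Pd d))) (hB : IsUpperSet (B : Set (Pd d))) :
    sStarD A B univ = 0 ↔ ∃ I : Finset (Fin d), (∀ x y : Pd d, (∀ a ∈ I, x a = y a) → (x ∈ A ↔ y ∈ A)) ∧
      (∀ x y : Pd d, (∀ a ∉ I, x a = y a) → (x ∈ B ↔ y ∈ B)) := by
  rw [sStarD_univ_eq_harrisSlack, sub_eq_zero, eq_comm]
  exact harrisSlack_eq_zero_iff A B hA hB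

end Summit.CriticalPhenomena.PercolationContinuityZ3.Theorems.SahiGridPattern
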